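import Mathlib
import Literature.AlgebraicGeometry.Resolution.CobordantChartCoefficients
import Literature.AlgebraicGeometry.Resolution.AxisPolyhedron
import Summits.ResolutionOfSingularities.ResolutionOfSingularities.Theorems.WeightedInvariantLocalWeightedDropAxisPreparationAux

/-!
# Helpers for the axis preparation, II: the Hasse–Taylor coefficients and the Taylor polynomial

Crux `LocalWeightedDrop` (stmt-ResolutionOfSingularities-8899, route ResolutionOfSingularities/WeightedInvariant),
line `hasse-ridge-face-selection`, registered stub `stub_axisPreparation` (B1, Hironaka's vertex dissolution with one
free variable).  Vocabulary of `Literature/…/AxisPolyhedron.lean`: in `k[[x'₁, …, x'ₙ, z]]`, `z = X (Fin.last n)`,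
`x'_j = X (Fin.castSucc j)`, `xDeg E = |a|` for `E = (a, c)`, `taylorCoeff d g lam E` = the coefficient of `X'^a` in
`F(X' + lam)` for the `z`-free degree-`d` part `F` of `g`.

Everything is written out over the finite set of `z`-FREE EXPONENTS OF DEGREE `d`
(`(univ.finsuppAntidiag d).filter (· z = 0)`; no new definitions):
* `taylorCoeff_eq_sum` — the Hasse–Taylor coefficient as a finite sum; it only depends on the `x'`-part of the
  exponent (`taylorCoeff_congr`), equals the coefficient itself in `x'`-degree `d` (`taylorCoeff_of_mem_axisExps`) and
  vanishes above (`taylorCoeff_eq_zero_of_lt`);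
* `coeff_prod_X_add_C_mul_X_pow`, `coeff_taylorPoly` — the TAYLOR POLYNOMIAL
  `Σ_B g_B ∏_j (x'_j + lam_j z^M)^{B_j} = F(X' + lam Z^M)` has the coefficient `taylorCoeff d g lam (a, c)` at `x'^a z^c`
  when `c = M (d - |a|)` and `0` otherwise (`M = 0` allowed: `F(X' + lam)`);
* `initEval_snoc_zero` — on `z = 0` the evaluated degree-`d` form is `Σ_B g_B u^B` over these exponents.
-/

set_option linter.dupNamespace false -- mandated namespace of this single-conjunct summit

namespace Summit.ResolutionOfSingularities.ResolutionOfSingularities.Theorems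

open Literature.AlgebraicGeometry.Resolution

namespace AxisPreparation

open MvPowerSeries AxisPolyhedron

variable {k : Type} [Field k] {n : ℕ}

/-! ### The `z`-free exponents of degree `d` and the Hasse–Taylor coefficients -/

/-- Membership in the finite set of `z`-free exponents of degree `d`. -/
theorem mem_axisExps {d : ℕ} {B : Fin (n + 1) →₀ ℕ} :
    B ∈ ((Finset.univ : Finset (Fin (n + 1))).finsuppAntidiag d).filter (fun B => B (Fin.last n) = 0) ↔
      B.degree = d ∧ B (Fin.last n) = 0 := by
  rw [Finset.mem_filter, ApexFreeOrderDrop.mem_antidiag_iff, ApexFreeOrderDrop.weight_one_eq_degree]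

/-- A `z`-free exponent of degree `d` has `x'`-degree `d`. -/
theorem xDeg_eq_of_mem_axisExps {d : ℕ} {B : Fin (n + 1) →₀ ℕ}
    (hB : B ∈ ((Finset.univ : Finset (Fin (n + 1))).finsuppAntidiag d).filter (fun B => B (Fin.last n) = 0)) :
    xDeg B = d := by
  obtain ⟨hd, h0⟩ := mem_axisExps.mp hB
  have h := degree_eq_xDeg_add B
  omega

/-- A binomial factor `C(B_j, E_j)` with `E_j > B_j` kills the Taylor product. -/
theorem prod_choose_mul_pow_eq_zero (lam : Fin n → k) {B E : Fin (n + 1) →₀ ℕ}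
    (h : ¬ ∀ j : Fin n, E (Fin.castSucc j) ≤ B (Fin.castSucc j)) :
    ∏ j : Fin n, (((B (Fin.castSucc j)).choose (E (Fin.castSucc j)) : k) *
      lam j ^ (B (Fin.castSucc j) - E (Fin.castSucc j))) = 0 := by
  push Not at h
  obtain ⟨j, hj⟩ := h
  exact Finset.prod_eq_zero (Finset.mem_univ j)
    (by rw [Nat.choose_eq_zero_of_lt hj, Nat.cast_zero, zero_mul])

/-- The Hasse–Taylor coefficient as a finite sum over the `z`-free exponents of degree `d` (the constraint
`E ≤ B` of the definition is automatic: otherwise a binomial factor vanishes). -/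
theorem taylorCoeff_eq_sum (d : ℕ) (g : MvPowerSeries (Fin (n + 1)) k) (lam : Fin n → k)
    (E : Fin (n + 1) →₀ ℕ) :
    taylorCoeff d g lam E =
      ∑ B ∈ ((Finset.univ : Finset (Fin (n + 1))).finsuppAntidiag d).filter (fun B => B (Fin.last n) = 0),
        coeff B g * ∏ j : Fin n, (((B (Fin.castSucc j)).choose (E (Fin.castSucc j)) : k) *
          lam j ^ (B (Fin.castSucc j) - E (Fin.castSucc j))) := by
  classical
  unfold taylorCoeff
  rw [finsum_eq_sum_of_support_subset _
    (s := ((Finset.univ : Finset (Fin (n + 1))).finsuppAntidiag d).filter (fun B => B (Fin.last n) = 0)) ?_]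
  · refine Finset.sum_congr rfl fun B hB => ?_
    obtain ⟨hd, h0⟩ := mem_axisExps.mp hB
    by_cases hle : ∀ j : Fin n, E (Fin.castSucc j) ≤ B (Fin.castSucc j)
    · rw [if_pos ⟨hd, h0, hle⟩]
    · rw [if_neg (fun h => hle h.2.2), prod_choose_mul_pow_eq_zero lam hle, mul_zero]
  · intro B hB
    rw [Finset.mem_coe, mem_axisExps]
    by_contra hne
    exact (Function.mem_support.mp hB) (if_neg fun h => hne ⟨h.1, h.2.1⟩)

/-- The Hasse–Taylor coefficient only depends on the `x'`-part of the exponent. -/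
theorem taylorCoeff_congr {d : ℕ} {g : MvPowerSeries (Fin (n + 1)) k} {lam : Fin n → k}
    {E E' : Fin (n + 1) →₀ ℕ} (h : ∀ j : Fin n, E (Fin.castSucc j) = E' (Fin.castSucc j)) :
    taylorCoeff d g lam E = taylorCoeff d g lam E' := by
  rw [taylorCoeff_eq_sum, taylorCoeff_eq_sum]
  simp only [h]

/-- In `x'`-degree `d` (and `z`-degree `0`) the Hasse–Taylor coefficient is the coefficient itself: the top-degree
part of `F(X' + lam)` is `F`. -/
theorem taylorCoeff_of_mem_axisExps {d : ℕ} (g : MvPowerSeries (Fin (n + 1)) k) (lam : Fin n → k)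
    {E : Fin (n + 1) →₀ ℕ}
    (hE : E ∈ ((Finset.univ : Finset (Fin (n + 1))).finsuppAntidiag d).filter (fun B => B (Fin.last n) = 0)) :
    taylorCoeff d g lam E = coeff E g := by
  rw [taylorCoeff_eq_sum, Finset.sum_eq_single E]
  · rw [Finset.prod_eq_one, mul_one]
    intro j _
    rw [Nat.choose_self, Nat.cast_one, Nat.sub_self, pow_zero, mul_one]
  · intro B hB hne
    rw [prod_choose_mul_pow_eq_zero lam ?_, mul_zero]
    intro hle
    apply hne
    have hsum : ∑ j : Fin n, E (Fin.castSucc j) = ∑ j : Fin n, B (Fin.castSucc j) := by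
      change xDeg E = xDeg B
      rw [xDeg_eq_of_mem_axisExps hE, xDeg_eq_of_mem_axisExps hB]
    have heq := (Finset.sum_eq_sum_iff_of_le fun j _ => hle j).mp hsum
    ext l
    rcases Fin.eq_castSucc_or_eq_last l with ⟨j, rfl⟩ | rfl
    · exact (heq j (Finset.mem_univ j)).symm
    · rw [(mem_axisExps.mp hB).2, (mem_axisExps.mp hE).2]
  · exact fun h => absurd hE h

/-- Above `x'`-degree `d` the Hasse–Taylor coefficient vanishes. -/
theorem taylorCoeff_eq_zero_of_lt {d : ℕ} (g : MvPowerSeries (Fin (n + 1)) k) (lam : Fin n → k)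
    {E : Fin (n + 1) →₀ ℕ} (h : d < xDeg E) : taylorCoeff d g lam E = 0 := by
  rw [taylorCoeff_eq_sum]
  refine Finset.sum_eq_zero fun B hB => ?_
  rw [prod_choose_mul_pow_eq_zero lam ?_, mul_zero]
  intro hle
  have : xDeg E ≤ xDeg B := Finset.sum_le_sum fun j _ => hle j
  rw [xDeg_eq_of_mem_axisExps hB] at this
  omega

/-! ### The Taylor polynomial `F(X' + lam Z^M)` and its coefficients -/

/-- Coefficients of `∏_j (x'_j + μ_j z^M)^{B_j}`: the monomial `x'^a z^c` occurs iff `c = M Σ_j (B_j - a_j)`, with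
coefficient `∏_j C(B_j, a_j) μ_j^{B_j - a_j}` (zero unless `a ≤ B`). -/
theorem coeff_prod_X_add_C_mul_X_pow (μ : Fin n → k) (M : ℕ) (B E : Fin (n + 1) →₀ ℕ) :
    MvPolynomial.coeff E (∏ j : Fin n, (MvPolynomial.X (Fin.castSucc j) +
        MvPolynomial.C (μ j) * MvPolynomial.X (Fin.last n) ^ M : MvPolynomial (Fin (n + 1)) k) ^
          (B (Fin.castSucc j))) =
      if E (Fin.last n) = M * ∑ j : Fin n, (B (Fin.castSucc j) - E (Fin.castSucc j)) then
        ∏ j : Fin n, (((B (Fin.castSucc j)).choose (E (Fin.castSucc j)) : k) *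
          μ j ^ (B (Fin.castSucc j) - E (Fin.castSucc j)))
      else 0 := by
  classical
  have hfac : ∀ j : Fin n, (MvPolynomial.X (Fin.castSucc j) +
      MvPolynomial.C (μ j) * MvPolynomial.X (Fin.last n) ^ M : MvPolynomial (Fin (n + 1)) k) ^
        (B (Fin.castSucc j)) =
      ∑ l ∈ Finset.range (B (Fin.castSucc j) + 1),
        MvPolynomial.C ((((B (Fin.castSucc j)).choose l : ℕ) : k) * μ j ^ (B (Fin.castSucc j) - l)) *
          (MvPolynomial.X (Fin.castSucc j) ^ l *
            MvPolynomial.X (Fin.last n) ^ (M * (B (Fin.castSucc j) - l))) := by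
    intro j
    rw [add_pow]
    refine Finset.sum_congr rfl fun l _ => ?_
    rw [mul_pow, ← pow_mul, map_mul, map_natCast, map_pow]
    ring
  simp_rw [hfac]
  rw [Finset.prod_univ_sum, MvPolynomial.coeff_sum]
  have hterm : ∀ L : Fin n → ℕ,
      (∏ j : Fin n, (MvPolynomial.C ((((B (Fin.castSucc j)).choose (L j) : ℕ) : k) *
          μ j ^ (B (Fin.castSucc j) - L j)) *
          (MvPolynomial.X (Fin.castSucc j) ^ (L j) *
            MvPolynomial.X (Fin.last n) ^ (M * (B (Fin.castSucc j) - L j))) :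
              MvPolynomial (Fin (n + 1)) k)) =
        MvPolynomial.monomial (Finsupp.equivFunOnFinite.symm
            (Fin.snoc L (M * ∑ j : Fin n, (B (Fin.castSucc j) - L j)) : Fin (n + 1) → ℕ))
          (∏ j : Fin n, ((((B (Fin.castSucc j)).choose (L j) : ℕ) : k) * μ j ^ (B (Fin.castSucc j) - L j))) := by
    intro L
    rw [MvPolynomial.monomial_eq, Finsupp.prod_pow, Fin.prod_univ_castSucc]
    simp only [Finsupp.coe_equivFunOnFinite_symm, Fin.snoc_castSucc, Fin.snoc_last, map_mul, map_prod, map_pow,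
      map_natCast, Finset.prod_mul_distrib, Finset.prod_pow_eq_pow_sum]
    rw [← Finset.mul_sum]
  simp_rw [hterm, MvPolynomial.coeff_monomial]
  rw [Finset.sum_eq_single (fun j => E (Fin.castSucc j))]
  · have hiff : Finsupp.equivFunOnFinite.symm
          (Fin.snoc (fun j => E (Fin.castSucc j))
            (M * ∑ j : Fin n, (B (Fin.castSucc j) - E (Fin.castSucc j))) : Fin (n + 1) → ℕ) = E ↔
        E (Fin.last n) = M * ∑ j : Fin n, (B (Fin.castSucc j) - E (Fin.castSucc j)) := by
      constructor
      · intro h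
        have h' := DFunLike.congr_fun h (Fin.last n)
        rw [Finsupp.coe_equivFunOnFinite_symm, Fin.snoc_last] at h'
        exact h'.symm
      · intro h
        ext l
        rw [Finsupp.coe_equivFunOnFinite_symm]
        rcases Fin.eq_castSucc_or_eq_last l with ⟨j, rfl⟩ | rfl
        · rw [Fin.snoc_castSucc]
        · rw [Fin.snoc_last, h]
    by_cases hc : E (Fin.last n) = M * ∑ j : Fin n, (B (Fin.castSucc j) - E (Fin.castSucc j))
    · rw [if_pos (hiff.mpr hc), if_pos hc]
    · rw [if_neg (fun h => hc (hiff.mp h)), if_neg hc]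
  · intro L _ hL
    rw [if_neg]
    intro h
    apply hL
    funext j
    have h' := DFunLike.congr_fun h (Fin.castSucc j)
    rw [Finsupp.coe_equivFunOnFinite_symm, Fin.snoc_castSucc] at h'
    exact h'
  · intro hL
    rw [Fintype.mem_piFinset] at hL
    push Not at hL
    obtain ⟨j, hj⟩ := hL
    rw [Finset.mem_range, not_lt] at hj
    have hzero : ∏ j : Fin n, ((((B (Fin.castSucc j)).choose (E (Fin.castSucc j)) : ℕ) : k) *
        μ j ^ (B (Fin.castSucc j) - E (Fin.castSucc j))) = 0 :=
      Finset.prod_eq_zero (Finset.mem_univ j)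
        (by rw [Nat.choose_eq_zero_of_lt (by omega), Nat.cast_zero, zero_mul])
    split_ifs
    · exact hzero
    · rfl

/-- COEFFICIENTS OF THE TAYLOR POLYNOMIAL `F(X' + lam Z^M) = Σ_B g_B ∏_j (x'_j + lam_j z^M)^{B_j}` (sum over the
`z`-free exponents `B` of degree `d`): the coefficient of `x'^a z^c` is the Hasse–Taylor coefficient
`taylorCoeff d g lam (a, c)` if `c = M (d - |a|)` and `0` otherwise (`M = 0` is allowed: `F(X' + lam)`). -/
theorem coeff_taylorPoly (d : ℕ) (g : MvPowerSeries (Fin (n + 1)) k) (lam : Fin n → k) (M : ℕ)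
    (E : Fin (n + 1) →₀ ℕ) :
    MvPolynomial.coeff E (∑ B ∈ ((Finset.univ : Finset (Fin (n + 1))).finsuppAntidiag d).filter
        (fun B => B (Fin.last n) = 0),
      MvPolynomial.C (coeff B g) * ∏ j : Fin n, (MvPolynomial.X (Fin.castSucc j) +
        MvPolynomial.C (lam j) * MvPolynomial.X (Fin.last n) ^ M : MvPolynomial (Fin (n + 1)) k) ^
          (B (Fin.castSucc j))) =
      if E (Fin.last n) = M * (d - xDeg E) then taylorCoeff d g lam E else 0 := by
  classical
  rw [MvPolynomial.coeff_sum, taylorCoeff_eq_sum]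
  simp_rw [MvPolynomial.coeff_C_mul, coeff_prod_X_add_C_mul_X_pow]
  have hsum : ∀ B ∈ ((Finset.univ : Finset (Fin (n + 1))).finsuppAntidiag d).filter
      (fun B => B (Fin.last n) = 0), (∀ j : Fin n, E (Fin.castSucc j) ≤ B (Fin.castSucc j)) →
      ∑ j : Fin n, (B (Fin.castSucc j) - E (Fin.castSucc j)) = d - xDeg E := by
    intro B hB hle
    have h1 : ∑ j : Fin n, (B (Fin.castSucc j) - E (Fin.castSucc j)) + xDeg E = xDeg B := by
      unfold xDeg
      rw [← Finset.sum_add_distrib]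
      exact Finset.sum_congr rfl fun j _ => Nat.sub_add_cancel (hle j)
    rw [xDeg_eq_of_mem_axisExps hB] at h1
    omega
  by_cases hc : E (Fin.last n) = M * (d - xDeg E)
  · rw [if_pos hc]
    refine Finset.sum_congr rfl fun B hB => ?_
    by_cases hle : ∀ j : Fin n, E (Fin.castSucc j) ≤ B (Fin.castSucc j)
    · rw [hsum B hB hle, if_pos hc]
    · rw [prod_choose_mul_pow_eq_zero lam hle]
      split_ifs <;> simp
  · rw [if_neg hc]
    refine Finset.sum_eq_zero fun B hB => ?_
    by_cases hle : ∀ j : Fin n, E (Fin.castSucc j) ≤ B (Fin.castSucc j)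
    · rw [hsum B hB hle, if_neg hc, mul_zero]
    · rw [prod_choose_mul_pow_eq_zero lam hle]
      split_ifs <;> simp

/-! ### Evaluating the degree-`d` form on `z = 0` -/

/-- On the hyperplane `z = 0` the evaluated degree-`d` form of `g` is `Σ_B g_B u^B` over the `z`-free exponents `B`
of degree `d`. -/
theorem initEval_snoc_zero (d : ℕ) (g : MvPowerSeries (Fin (n + 1)) k) (u : Fin n → k) :
    CobordantChart.initEval (fun _ : Fin (n + 1) => 1) (Fin.snoc u 0 : Fin (n + 1) → k) d g =
      ∑ B ∈ ((Finset.univ : Finset (Fin (n + 1))).finsuppAntidiag d).filter (fun B => B (Fin.last n) = 0),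
        coeff B g * ∏ j : Fin n, u j ^ (B (Fin.castSucc j)) := by
  classical
  rw [ApexFreeOrderDrop.initEval_one_eq_sum,
    ← Finset.sum_filter_add_sum_filter_not _ (fun B : Fin (n + 1) →₀ ℕ => B (Fin.last n) = 0)]
  have h2 : ∑ B ∈ ((Finset.univ : Finset (Fin (n + 1))).finsuppAntidiag d).filter
      (fun B => ¬ B (Fin.last n) = 0), coeff B g * ∏ i, (Fin.snoc u 0 : Fin (n + 1) → k) i ^ (B i) = 0 := by
    refine Finset.sum_eq_zero fun B hB => ?_
    rw [Fin.prod_univ_castSucc, Fin.snoc_last, zero_pow (Finset.mem_filter.mp hB).2, mul_zero, mul_zero]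
  rw [h2, add_zero]
  refine Finset.sum_congr rfl fun B hB => ?_
  rw [Fin.prod_univ_castSucc, Fin.snoc_last, (Finset.mem_filter.mp hB).2, pow_zero, mul_one]
  simp only [Fin.snoc_castSucc]

end AxisPreparation

end Summit.ResolutionOfSingularities.ResolutionOfSingularities.Theorems
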